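import Summits.BirchSwinnertonDyer.Rank1Residual.X11a.PartnerNonsplitSign
import Summits.BirchSwinnertonDyer.Rank1Residual.X11b.FrobeniusTraceMultiplicative
import HarnessLib

/-!
# Class X11a, route (3d): `a_p(A) ≡ a_p(E) (mod p)` along a `p`-congruence at a multiplicative prime
# (cell `b2b-bsdres`, unit `b2b-bsdres-x11a`, gen 25)

HONEST FRAMING (run/shared/lean/b2b/bsd-rank1-residual/, verbatim in every file): the goal of the
cell is to DELETE the COMBINATION-SHAPED residual classes of the Birch–Swinnerton-Dyer formula for
ALL analytic-rank `≤ 1` elliptic curves over `ℚ` — "full BSD formula for every rank `≤ 1` curve in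
class `C`" assembled STRICTLY from published theorems — so that the rank-`≤ 1` remainder becomes
exactly the CONSTRUCTION-SHAPED classes, which are TYPED (missing-input `Prop`s), NOT attempted.
This is not "finishing BSD". Research route; NO CLAIM BEYOND STATED CLASSES. Theorems only; no
definition, no new named fact; nothing booked; no label change.

WHAT. The unified form of gen 24's split theorem (`PartnerOrdinary.dvd_frobeniusTrace_sub_one_of_equiv_of_split_of_good`,
binder A40) and gen 25's non-split theorem (`PartnerNonsplitSign.dvd_frobeniusTrace_add_one_of_equiv_of_not_split`,
binder A41): for `E = W/ℚ` multiplicative at the odd prime `p`, `A` good at `p` and `A[p] ≃ E[p]`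
`Γ_ℚ`-equivariantly, **`a_p(A) ≡ a_p(E) (mod p)`**, where Silverman's `a_p(E) ∈ {+1, -1}` is
`W.frobeniusTrace p - 1` in the tree's convention (`frobeniusTrace = p + 1 - #W̃(𝔽_p)` counts the
non-singular points, so it is `2` / `0` at a split / non-split prime:
`X11b.LocalTorsion.frobeniusTrace_eq_two_of_split` / `…_eq_zero_of_nonsplit`). Plus the C1-shaped
(`∃ e`) wrappers consumed by the route-(3d) booking files. Nothing booked; the class label is unchanged.

References: [Serre1972] §1.11 (1), Prop. 11–12, §1.12; [SilvermanAEC2009] Ex. 3.5, VII.5;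
HOME/b2b-bsdres-x11a/REPORT-g25.md.
-/

noncomputable section

open scoped Classical

open Field WeierstrassCurve Literature.NumberTheory.EllipticCurves
  Literature.NumberTheory.EllipticCurves.Rank1Residual

set_option autoImplicit false

namespace Summit.BirchSwinnertonDyer.Rank1Residual.X11a.PartnerNonsplitSign

variable {W A : WeierstrassCurve ℚ} [W.IsElliptic] [W.IsGloballyMinimal] [A.IsElliptic]
  [A.IsGloballyMinimal] {p : ℕ} [hp : Fact p.Prime]

/-- **`a_p(A) ≡ a_p(E) (mod p)` along a `p`-congruence at a multiplicative prime** (`p` odd, `A` good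
at `p`, any `E[p]`): `p ∣ a_p(A) - (W.frobeniusTrace p - 1)`, the bracket being Silverman's
`a_p(E) = +1` (split) / `-1` (non-split). Granted A40 (`hT`) and A41 (`hT'`), the Tate
uniformisation facts of the split / non-split halves. [cite: Serre1972, §1.11 (1), Prop. 11–12, §1.12]
[cite: SilvermanATAEC1994, Ch. V Thm. 3.1, Lemma 5.2 (c), Thm. 5.3, Cor. 5.4] -/
theorem dvd_frobeniusTrace_sub_of_equiv (hT : Silverman1994_thmV53_tateUniformisation.{0})
    (hT' : Silverman1994_thmV53_corV54_tateUniformisation.{0}) (hp2 : p ≠ 2)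
    (hmult : W.HasMultiplicativeReductionAtPrime p) (hgoodA : A.HasGoodReductionAtPrime p)
    (e : geomTorsion A (p : ℤ) ≃+ geomTorsion W (p : ℤ))
    (he : ∀ (σ : absoluteGaloisGroup ℚ) (P : geomTorsion A (p : ℤ)), e (σ • P) = σ • e P) :
    (p : ℤ) ∣ A.frobeniusTrace p - (W.frobeniusTrace p - 1) := by
  by_cases hs : W.HasSplitMultiplicativeReductionAtPrime p
  · rw [X11b.LocalTorsion.frobeniusTrace_eq_two_of_split W p hmult hs]
    have h := PartnerOrdinary.dvd_frobeniusTrace_sub_one_of_equiv_of_split_of_good hT hp2 hs hgoodA e he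
    convert h using 1
    ring
  · rw [X11b.LocalTorsion.frobeniusTrace_eq_zero_of_nonsplit W p hmult hs]
    have h := dvd_frobeniusTrace_add_one_of_equiv_of_not_split hT' hp2 hmult hs hgoodA e he
    convert h using 1
    ring

/-- C1-shaped (`∃ e`) form of the non-split theorem, for the route-(3d) booking files.
[cite: Serre1972, §1.11 (1), §1.12] [cite: GreenbergVatsal2000, §2 pp. 14–15] -/
theorem dvd_frobeniusTrace_add_one_of_torsionIso_of_not_split
    (hT' : Silverman1994_thmV53_corV54_tateUniformisation.{0}) (hp2 : p ≠ 2)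
    (hmult : W.HasMultiplicativeReductionAtPrime p)
    (hns : ¬ W.HasSplitMultiplicativeReductionAtPrime p) (hgoodA : A.HasGoodReductionAtPrime p)
    (hC1 : ∃ e : geomTorsion A (p : ℤ) ≃+ geomTorsion W (p : ℤ),
      ∀ (σ : absoluteGaloisGroup ℚ) (P : geomTorsion A (p : ℤ)), e (σ • P) = σ • e P) :
    (p : ℤ) ∣ A.frobeniusTrace p + 1 := by
  obtain ⟨e, he⟩ := hC1
  exact dvd_frobeniusTrace_add_one_of_equiv_of_not_split hT' hp2 hmult hns hgoodA e he

/-- C1-shaped (`∃ e`) form of the congruence `a_p(A) ≡ a_p(E) (mod p)`.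
[cite: Serre1972, §1.11 (1), Prop. 11–12, §1.12] -/
theorem dvd_frobeniusTrace_sub_of_torsionIso (hT : Silverman1994_thmV53_tateUniformisation.{0})
    (hT' : Silverman1994_thmV53_corV54_tateUniformisation.{0}) (hp2 : p ≠ 2)
    (hmult : W.HasMultiplicativeReductionAtPrime p) (hgoodA : A.HasGoodReductionAtPrime p)
    (hC1 : ∃ e : geomTorsion A (p : ℤ) ≃+ geomTorsion W (p : ℤ),
      ∀ (σ : absoluteGaloisGroup ℚ) (P : geomTorsion A (p : ℤ)), e (σ • P) = σ • e P) :
    (p : ℤ) ∣ A.frobeniusTrace p - (W.frobeniusTrace p - 1) := by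
  obtain ⟨e, he⟩ := hC1
  exact dvd_frobeniusTrace_sub_of_equiv hT hT' hp2 hmult hgoodA e he

end Summit.BirchSwinnertonDyer.Rank1Residual.X11a.PartnerNonsplitSign

end
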